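import Summits.Langlands.Langlands.Theorems.IrreducibilityBySelfDualityReciprocityUpToIrreducibilityCorrespondsConj
import Summits.Langlands.Langlands.Theorems.WachComponentCensusLiftB2UnramSplitPInPrint
import Literature.NumberTheory.Automorphic.HilbertModularLocalGlobal
import Literature.NumberTheory.Automorphic.HilbertModularLocalGlobalPinned
import Literature.NumberTheory.Automorphic.HilbertModularGaloisRep
import HarnessLib

/-!
# Line `Sketch` for the crux `ReciprocityUpToIrreducibility` (item stmt-Langlands-14328), continuation c5:
# stub A-Hilbert — direction (A) of the summit on the Hilbert-modular sector

Support file (closes nothing; registered stub `stub_hilbert_automorphicToGalois` of the checked skeleton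
`Lines/Sketch.lean`, wave 2 of continuation lead c5).  Conditional result: the three hypotheses are the
named facts lang.S27 `exists_galoisRep_of_regularAlgebraic` (Carayol–Taylor–Blasius–Rogawski for
`n = 2`), `galoisRep_GL2_totallyReal_irreducible` (Ribet; Skinner 2009 §2.4.2) and
`galoisRep_GL2_totallyReal_localGlobal_pinned` (Carayol 1986, Saito, Skinner 2009 Thm. 1, in the summit's
pinned vocabulary, with ONE family `llc` of local Langlands data per totally real field, normalised
against THE local Artin maps: the two pins `(llc v).artin.IsCanonical`, `((llc v).eps.artin E).IsCanonical`
— Skinner 2009 p. 242, Harris–Taylor 2001 Introduction; file `HilbertModularLocalGlobalPinned`).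

**Re-type of 2026-08-16/17.**  The summit's `ReciprocityData K` now has THREE fields (`llc`,
`llc_isCanonical`, `llc_eps_isCanonical`), so that `∀ 𝓡` ranges over Henniart-normalised data only.  The
former third hypothesis, the UNPINNED `galoisRep_GL2_totallyReal_localGlobal` (a bare family `llc`), no
longer assembles a reciprocity datum — the two pins are not derivable from a bare `LocalLanglandsDatum`
(its `artin` carries four of the five characterising clauses of `canonicalArtin`, module docstring of
`GaloisRepresentations/LocalClassFieldTheory`, "Variant R") — so the stub is restated with the SAME
conclusion from the pinned re-vendoring of that fact (which implies the unpinned one: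
`galoisRep_GL2_totallyReal_localGlobal_of_pinned`) as `stub_hilbert_automorphicToGalois_of_pinned`, the
registered name `stub_hilbert_automorphicToGalois` being kept as a `@[deprecated]` alias of it (Theorems
files are append-only), exactly as its sibling
`Summit.Langlands.Langlands.Theorems.liftB2UnramSplitP_of_pinned_facts` / `liftB2UnramSplitP_of_facts`
(`WachComponentCensusLiftB2UnramSplitPInPrint`, p169195).  What the unpinned fact alone still yields
(irreducible `ρ` attached a.e., pinned-geometric, unique up to conjugacy — everything but `Corresponds`)
is recorded as `hilbert_exists_irreducible_geometric_of_unpinned`.  Consumers (`Lines/Sketch.lean` §1j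
`hilbert_automorphicToGalois`, `hilbert_weakReciprocity_A`) must thread the pinned fact.

For `K` totally real the reciprocity datum is `Rec := ⟨llc, hcan, hcanE⟩`; `Rec.pst ℓ v hv` is Fontaine's
pinned `fontainePstAdicCompletion v ℓ hv` by `rfl`, so the de Rham clause and the local–global clause of
the named fact are LITERALLY the summit's `IsGeometricFramed Rec ρ` (second conjunct) and
`LocalGlobalCompatibleAt Rec ι π ρ v`.  Existence of an irreducible `ρ` attached to `π` almost
everywhere is the tree's `exists_irreducible_satakeFrobCompatibleAE_GL2` (lang.S27 + Ribet through the
half-twist `π ↦ π ⊗ |det|^{1/2}`), and uniqueness up to conjugacy is Chebotarev + Brauer–Nesbitt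
(`isConjugate_of_satakeFrobCompatibleAt`, c2).  No definitions; std axioms.
-/

noncomputable section

set_option linter.dupNamespace false -- project-wide option (lakefile weak.linter.dupNamespace); `Summit.Langlands.Langlands` is the mandated namespace

open scoped MatrixGroups Matrix NumberField Classical Polynomial
open Filter IsDedekindDomain Field Polynomial
open Literature.NumberTheory.Automorphic Literature.NumberTheory.GaloisRepresentations
open Literature.NumberTheory.PAdicHodge
open Summit.Langlands

namespace Summit.Langlands.Langlands.Theorems.ReciprocityUpToIrreducibility

/-- **Stub A-Hilbert (direction (A) of the summit on the Hilbert-modular sector, modulo three named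
facts).**  For `K` totally real there is ONE reciprocity datum `Rec` (the family `llc` of
`galoisRep_GL2_totallyReal_localGlobal_pinned`, Harris–Taylor's `rec_v` normalised against THE local
Artin maps, with its two canonicity pins) such that every cuspidal `π` on `GL₂(𝔸_K)`, L-algebraic with
a regular infinity type, has for all `ℓ`, `ι` an irreducible `ρ : Γ_K → GL₂(ℚ̄_ℓ)`, geometric for the
pinned datum, with `Corresponds Rec ι π ρ` (Satake–Frobenius a.e. + local–global compatibility at EVERY
finite place), unique up to conjugacy: existence and a.e. compatibility by
`Summit.Langlands.Langlands.Theorems.exists_irreducible_satakeFrobCompatibleAE_GL2` (lang.S27 + Ribet via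
the half-twist), de Rham above `ℓ` and the local–global clause verbatim from the named fact, uniqueness by
Chebotarev + Brauer–Nesbitt (`isConjugate_of_satakeFrobCompatibleAt`, c2).  Since the 2026-08-16/17
re-type of `ReciprocityData` (fields `llc_isCanonical`, `llc_eps_isCanonical`) the third hypothesis is the
PINNED local–global fact (module docstring); the conclusion is that of the registered stub, unchanged.
[cite: CarayolASENS1986, Thm. (A)] [cite: Skinner2009, Thm. 1 and §2.4.2] [cite: TaylorInventMath1989, Theorem]
[cite: HarrisTaylorAMS2001, Introduction and Thm. A] [cite: BuzzardGeeLMS2014, Conj. 3.2.1–3.2.2 and §5.3] -/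
theorem stub_hilbert_automorphicToGalois_of_pinned :
    exists_galoisRep_of_regularAlgebraic → galoisRep_GL2_totallyReal_irreducible →
    galoisRep_GL2_totallyReal_localGlobal_pinned →
    ∀ (K : Type) [Field K] [NumberField K], NumberField.IsTotallyReal K → ∃ Rec : ReciprocityData K,
      ∀ (hcpt : isCompact_glFiniteIntegralLevel 2 K) (π : CuspidalAutomorphicRepData 2 K hcpt),
        π.1.IsLAlgebraic → (∃ T : InfinityType K 2, π.1.HasInfinityType T ∧ T.IsRegular) →
        ∀ (ℓ : ℕ) [Fact ℓ.Prime] (ι : PadicAlgCl ℓ ≃+* ℂ),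
          ∃ ρ : FramedGaloisRep K (PadicAlgCl ℓ) 2,
            ρ.toGaloisRep.IsIrreducible ∧ IsGeometricFramed Rec ρ ∧ Corresponds Rec ι π.1 ρ ∧
              ∀ ρ' : FramedGaloisRep K (PadicAlgCl ℓ) 2, Corresponds Rec ι π.1 ρ' → IsConjugate ρ ρ' := by
  intro h27 hirrFact hLG K _ _ hK
  obtain ⟨llc, hcan, hcanE, hllc⟩ := hLG K hK
  refine ⟨⟨llc, hcan, hcanE⟩, fun hcpt π hL hreg ℓ _ ι => ?_⟩
  haveI := hK
  obtain ⟨r, hirr, hae⟩ :=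
    Summit.Langlands.Langlands.Theorems.exists_irreducible_satakeFrobCompatibleAE_GL2 h27 hirrFact π hL
      hreg ℓ ι
  obtain ⟨hdR, hLGC⟩ := hllc hcpt π hL hreg ℓ ι r hirr hae
  exact ⟨r, hirr, ⟨hae.eventually_isUnramifiedAt.mono fun _ h => h.2, hdR⟩, ⟨hae, hLGC⟩,
    fun ρ' hρ' => isConjugate_of_satakeFrobCompatibleAt π.1 ι hirr hae hρ'.1⟩

/-- **Deprecated record (the registered stub name).**  Formerly stub A-Hilbert from the same two facts
and the UNPINNED `galoisRep_GL2_totallyReal_localGlobal` (a bare family `llc`, reciprocity datum `⟨llc⟩`,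
landed p127779).  Since the 2026-08-16/17 re-type of `ReciprocityData` (fields `llc_isCanonical`,
`llc_eps_isCanonical`) that family no longer assembles a reciprocity datum — the pins are not derivable
from a bare local Langlands datum — so the name is kept (Theorems files are append-only) as an alias of
`stub_hilbert_automorphicToGalois_of_pinned`, whose third hypothesis is the pinned re-vendoring
`galoisRep_GL2_totallyReal_localGlobal_pinned`; same conclusion.
[cite: Skinner2009, Thm. 1 and §2.4.2] [cite: HarrisTaylorAMS2001, Introduction and Thm. A] -/
@[deprecated stub_hilbert_automorphicToGalois_of_pinned (since := "2026-08-17")]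
alias stub_hilbert_automorphicToGalois := stub_hilbert_automorphicToGalois_of_pinned

/-- **What the UNPINNED fact still gives** (record of the former third hypothesis
`galoisRep_GL2_totallyReal_localGlobal`, a bare family `llc`): for `K` totally real, every cuspidal `π`
on `GL₂(𝔸_K)`, L-algebraic with a regular infinity type, has for all `ℓ`, `ι` an irreducible
`ρ : Γ_K → GL₂(ℚ̄_ℓ)` attached to `π` at almost every place (`SatakeFrobCompatibleAE`), de Rham above
`ℓ` for Fontaine's pinned datum — i.e. `IsGeometricFramed Rec ρ` for EVERY reciprocity datum `Rec`, since
`Rec.pst` does not depend on `Rec` — and unique up to conjugacy among the representations attached to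
`π` a.e.; the local–global clause of the unpinned fact is relative to ITS family `llc`, which no longer
packages as a `ReciprocityData` (module docstring), so `Corresponds` is not concluded here.
[cite: Skinner2009, Thm. 1 and §2.4.2] [cite: BuzzardGeeLMS2014, Conj. 3.2.2 and §5.3] -/
theorem hilbert_exists_irreducible_geometric_of_unpinned (h27 : exists_galoisRep_of_regularAlgebraic)
    (hirrFact : galoisRep_GL2_totallyReal_irreducible) (hLG : galoisRep_GL2_totallyReal_localGlobal)
    (K : Type) [Field K] [NumberField K] (hK : NumberField.IsTotallyReal K)
    (Rec : ReciprocityData K) {hcpt : isCompact_glFiniteIntegralLevel 2 K}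
    (π : CuspidalAutomorphicRepData 2 K hcpt) (hL : π.1.IsLAlgebraic)
    (hreg : ∃ T : InfinityType K 2, π.1.HasInfinityType T ∧ T.IsRegular)
    (ℓ : ℕ) [Fact ℓ.Prime] (ι : PadicAlgCl ℓ ≃+* ℂ) :
    ∃ ρ : FramedGaloisRep K (PadicAlgCl ℓ) 2,
      ρ.toGaloisRep.IsIrreducible ∧ IsGeometricFramed Rec ρ ∧ SatakeFrobCompatibleAE ι π.1 ρ ∧
        ∀ ρ' : FramedGaloisRep K (PadicAlgCl ℓ) 2, SatakeFrobCompatibleAE ι π.1 ρ' → IsConjugate ρ ρ' := by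
  obtain ⟨llc, hllc⟩ := hLG K hK
  haveI := hK
  obtain ⟨r, hirr, hae⟩ :=
    Summit.Langlands.Langlands.Theorems.exists_irreducible_satakeFrobCompatibleAE_GL2 h27 hirrFact π hL
      hreg ℓ ι
  obtain ⟨hdR, -⟩ := hllc hcpt π hL hreg ℓ ι r hirr hae
  exact ⟨r, hirr, ⟨hae.eventually_isUnramifiedAt.mono fun _ h => h.2, hdR⟩, hae,
    fun ρ' hρ' => isConjugate_of_satakeFrobCompatibleAt π.1 ι hirr hae hρ'⟩

end Summit.Langlands.Langlands.Theorems.ReciprocityUpToIrreducibility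

end
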